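import Mathlib
import Summits.BirchSwinnertonDyer.BirchSwinnertonDyer.Theorems.KatoDescentTamePotSupersingularTameLowerFibreAdjointBricksFiveLimit

/-!
# Bricks for the `GL₂(𝔽₅)`-lifting route (T5′), XVII: the `ℤ₅` currency — `u · SL₂(ℤ₅) · u⁻¹ ⊆ G`

Continuation of file XVI (`…AdjointBricksFiveLimit`, same namespace). File XVI concludes, for a closed
`G ≤ GL₂(A)` covering `GL₂(𝔽₅)` modulo `𝔪` (`(A, 𝔪)` precomplete with finite levels, `5 ∈ 𝔪 ∌ 1`, units off
`𝔪`), that some `u ≡ 1 (mod 𝔪)` conjugates into `G` every matrix with `(det)⁴ = 1` and entries in the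
`𝔪`-adic closure of `ℤ`. This file reads that conclusion in Kato's (12.5.2) / Skinner–Urban currency: for ANY
ring map `φ : ℤ₅ → A` (e.g. the structure map of `A = 𝒪_𝔭`, `𝔭 ∣ 5`), the image of `SL₂(ℤ₅)` consists of such
matrices (`x ≡ appr x n (mod 5ⁿ)` in `ℤ₅` and `φ(5ⁿℤ₅) ⊆ 𝔪ⁿ`), so **`u · φ(SL₂(ℤ₅)) · u⁻¹ ⊆ G`**:
`exists_conj_SL2_padicInt_le_of_closed`. This is (T5′) of ARM-P r07 S7 ADD-1 §C (C0) in full («a closed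
`G ≤ GL₂(A)` with residual image `GL₂(𝔽₅)` contains a conjugate of `SL₂(W(𝔽₅)) = SL₂(ℤ₅)`»), for every
local pair `(A, 𝔪)` of residue characteristic `5` with finite levels — the `(2, 𝔽₅)` case that [M]
(Manoharmayum 2015) excludes, true for residual image `GL₂(𝔽₅)` and false for `SL₂(𝔽₅)` (Remark 4.4).
Route-free, no definitions, nothing about elliptic curves or items 19618/19981 (open). Target T-S7r07-1
(`FibreLatticeInput 5`, Δ1@5).
-/

set_option linter.dupNamespace false

open Matrix

namespace Summit.BirchSwinnertonDyer.BirchSwinnertonDyer.Theorems.GL2F5AdjointBricks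

section padic

universe u

/-- The image of a `5`-adic integer under any ring map `φ : ℤ₅ → A` lies in the `𝔪`-adic closure of `ℤ`
when `5 ∈ 𝔪`: `φ x ≡ appr x n (mod 𝔪ⁿ)`. -/
theorem exists_int_sub_mem_pow_of_padicInt [Fact (Nat.Prime 5)] {A : Type u} [CommRing A] (𝔪 : Ideal A)
    (h5 : (5 : A) ∈ 𝔪) (φ : ℤ_[5] →+* A) (x : ℤ_[5]) (n : ℕ) : ∃ z : ℤ, φ x - (z : A) ∈ 𝔪 ^ n := by
  refine ⟨(PadicInt.appr x n : ℤ), ?_⟩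
  have h := PadicInt.appr_spec n x
  rw [Ideal.mem_span_singleton] at h
  obtain ⟨c, hc⟩ := h
  have e : φ x - ((PadicInt.appr x n : ℤ) : A) = φ (x - (PadicInt.appr x n : ℤ_[5])) := by
    rw [map_sub, map_natCast, Int.cast_natCast]
  rw [e, hc, map_mul, map_pow, map_natCast, Nat.cast_ofNat]
  exact Ideal.mul_mem_right _ _ (Ideal.pow_mem_pow h5 n)

/-- **(T5′) in `ℤ₅` currency (ARM-P r07 S7 ADD-1 §C (C0), with (h)).** Let `(A, 𝔪)` be a precomplete
local pair with finite levels, `5 ∈ 𝔪 ∌ 1`, units off `𝔪`; let `G ≤ GL₂(A)` be closed (entrywise modulo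
every `𝔪ⁿ`) and cover `GL₂(𝔽₅)` modulo `𝔪`. Then for some `u ∈ GL₂(A)` with `u ≡ 1 (mod 𝔪)` and EVERY ring
map `φ : ℤ₅ → A`: `u · φ(s) · u⁻¹ ∈ G` for all `s ∈ SL₂(ℤ₅)` — `G` contains a conjugate of `SL₂(ℤ₅)`. -/
theorem exists_conj_SL2_padicInt_le_of_closed [Fact (Nat.Prime 5)] (A : Type u) [CommRing A] (𝔪 : Ideal A)
    [IsPrecomplete 𝔪 A]
    (hfin : ∀ n : ℕ, Finite (A ⧸ 𝔪 ^ (n + 1))) (h5 : (5 : A) ∈ 𝔪) (h1 : (1 : A) ∉ 𝔪)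
    (hloc : ∀ a : A, a ∉ 𝔪 → IsUnit a) (G : Subgroup (GL (Fin 2) A))
    (hclosed : ∀ g : GL (Fin 2) A, (∀ n : ℕ, ∃ g' ∈ G, ∀ i j, g.val i j - g'.val i j ∈ 𝔪 ^ n) → g ∈ G)
    (hres : ∀ q : GL (Fin 2) (ZMod 5), ∃ g ∈ G, ∀ i j, g.val i j - ((q.val i j).val : ℕ) ∈ 𝔪) :
    ∃ u : GL (Fin 2) A, (∀ i j, u.val i j - (1 : Matrix (Fin 2) (Fin 2) A) i j ∈ 𝔪) ∧
      ∀ (φ : ℤ_[5] →+* A) (s : Matrix.SpecialLinearGroup (Fin 2) ℤ_[5]),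
        u * Matrix.GeneralLinearGroup.map φ (Matrix.SpecialLinearGroup.toGL s) * u⁻¹ ∈ G := by
  obtain ⟨u, hu1, hu⟩ := exists_conj_proSmu_le_of_closed A 𝔪 hfin h5 h1 hloc G hclosed hres
  refine ⟨u, hu1, fun φ s => hu _ ?_ fun n i j => ?_⟩
  · have hd : Matrix.det ((Matrix.GeneralLinearGroup.map φ (Matrix.SpecialLinearGroup.toGL s) :
        GL (Fin 2) A) : Matrix (Fin 2) (Fin 2) A) = φ (Matrix.det (s : Matrix (Fin 2) (Fin 2) ℤ_[5])) := by
      rw [RingHom.map_det]; rfl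
    rw [hd, s.prop, map_one, one_pow]
  · rw [Matrix.GeneralLinearGroup.map_apply, Matrix.SpecialLinearGroup.coe_GL_coe_matrix]
    exact exists_int_sub_mem_pow_of_padicInt 𝔪 h5 φ _ n

/-- **(T5′) for complete local rings (class-level hypotheses).** The same as
`exists_conj_SL2_padicInt_le_of_closed` for `A` a local ring, adically complete for its maximal ideal `𝔪`,
with `5 ∈ 𝔪` and finite levels `A/𝔪^{n+1}` — e.g. `A = 𝒪_𝔭`, the ring of integers of a finite extension of
`ℚ₅`: a closed `G ≤ GL₂(A)` whose reduction covers `GL₂(𝔽₅)` contains `u · φ(SL₂(ℤ₅)) · u⁻¹` for some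
`u ≡ 1 (mod 𝔪)` and every ring map `φ : ℤ₅ → A`. -/
theorem exists_conj_SL2_padicInt_le_of_closed_localRing [Fact (Nat.Prime 5)] (A : Type u) [CommRing A]
    [IsLocalRing A] [IsAdicComplete (IsLocalRing.maximalIdeal A) A]
    (hfin : ∀ n : ℕ, Finite (A ⧸ IsLocalRing.maximalIdeal A ^ (n + 1)))
    (h5 : (5 : A) ∈ IsLocalRing.maximalIdeal A) (G : Subgroup (GL (Fin 2) A))
    (hclosed : ∀ g : GL (Fin 2) A,
      (∀ n : ℕ, ∃ g' ∈ G, ∀ i j, g.val i j - g'.val i j ∈ IsLocalRing.maximalIdeal A ^ n) → g ∈ G)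
    (hres : ∀ q : GL (Fin 2) (ZMod 5), ∃ g ∈ G, ∀ i j,
      g.val i j - ((q.val i j).val : ℕ) ∈ IsLocalRing.maximalIdeal A) :
    ∃ u : GL (Fin 2) A, (∀ i j, u.val i j - (1 : Matrix (Fin 2) (Fin 2) A) i j ∈ IsLocalRing.maximalIdeal A) ∧
      ∀ (φ : ℤ_[5] →+* A) (s : Matrix.SpecialLinearGroup (Fin 2) ℤ_[5]),
        u * Matrix.GeneralLinearGroup.map φ (Matrix.SpecialLinearGroup.toGL s) * u⁻¹ ∈ G :=
  exists_conj_SL2_padicInt_le_of_closed A (IsLocalRing.maximalIdeal A) hfin h5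
    (fun h => (IsLocalRing.mem_maximalIdeal _).1 h isUnit_one)
    (fun a ha => by
      by_contra hu
      exact ha ((IsLocalRing.mem_maximalIdeal a).2 hu))
    G hclosed hres

end padic

end Summit.BirchSwinnertonDyer.BirchSwinnertonDyer.Theorems.GL2F5AdjointBricks
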